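import Summits.Ventures.DiscreteObjects.UnitDistance.ThreeIntegralColouring
import Summits.Ventures.DiscreteObjects.UnitDistance.OddCycles
import Mathlib.NumberTheory.Real.Irrational
import HarnessLib

/-!
# The 3-integral sub-plane of `ℚ(√d)²`, `d ≡ 2 (mod 3)`: chromatic number exactly `3`
(cell `pub-namedobj`, target (U), seat udg g15)

Framing (verbatim for the cell): lottery ticket; floor = certified bounds/negative ranges.

`ThreeIntegralColouring.lean` reduces integer-coordinate unit-distance graphs of `ℚ(√d)²` (`d ≡ 2 (mod 3)`) with a denominator prime to `3`
into the `3`-colourable graph `UD(F₉²)`.  Here the same reduction colours the whole 3-INTEGRAL SUB-PLANE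
`T_d = {((A + B√d)/D, (C + E√d)/D) : A, B, C, E ∈ ℤ, D ∈ ℕ, 3 ∤ D} ⊂ ℚ(√d)²` (an infinite induced subgraph of the unit-distance graph of the
plane): `χ(T_d) ≤ 3` (`colorable_three_threeIntegralPoints`), and for `d ≡ 11 (mod 12)` a closed unit walk of odd length `d` INSIDE `T_d` — the
zigzag on the unit vector `((d−9)/(d+9), 6√d/(d+9))`, whose denominator `(d+9)/2` is prime to `3` (the zigzag of `OddCycles.lean` has denominator
`(d+1)/2 ≡ 0 (mod 3)` and leaves `T_d`) — gives `χ(T_d) = 3` EXACTLY (`chromaticNumber_threeIntegralPoints`).  For the census this pins the open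
row `d = 83` (`χ(ℚ(√83)²) ∈ {3, 4}`): a fourth colour, if it is needed at all, is forced only by unit vectors with a `3` in the denominator,
and every finite witness must contain one.  Elementary; formalisation ours; nothing here is literature.
-/

noncomputable section

namespace Summit.Ventures.DiscreteObjects.UnitDistance

open SimpleGraph IntermediateField
open scoped IntermediateField

/-! ## The 3-integral points and their colouring -/

/-- The plane point with integer data `q = (A, B, C, E)` over the denominator `D`: `((A + B√d)/D, (C + E√d)/D)`. -/
def intPt (d D : ℕ) (q : ℤ × ℤ × ℤ × ℤ) : EuclideanSpace ℝ (Fin 2) :=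
  !₂[((q.1 : ℝ) + (q.2.1 : ℝ) * Real.sqrt d) / D, ((q.2.2.1 : ℝ) + (q.2.2.2 : ℝ) * Real.sqrt d) / D]

/-- First coordinate of `intPt`. -/
@[simp] theorem intPt_apply_zero (d D : ℕ) (q : ℤ × ℤ × ℤ × ℤ) :
    intPt d D q 0 = ((q.1 : ℝ) + (q.2.1 : ℝ) * Real.sqrt d) / D := by simp [intPt]

/-- Second coordinate of `intPt`. -/
@[simp] theorem intPt_apply_one (d D : ℕ) (q : ℤ × ℤ × ℤ × ℤ) :
    intPt d D q 1 = ((q.2.2.1 : ℝ) + (q.2.2.2 : ℝ) * Real.sqrt d) / D := by simp [intPt]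

/-- THE 3-INTEGRAL SUB-PLANE `T_d`: points `((A + B√d)/D, (C + E√d)/D)` with `3 ∤ D`. -/
def threeIntegralPoints (d : ℕ) : Set (EuclideanSpace ℝ (Fin 2)) :=
  {p | ∃ D : ℕ, ¬ 3 ∣ D ∧ ∃ q : ℤ × ℤ × ℤ × ℤ, p = intPt d D q}

/-- `intPt d D q ∈ T_d` for `3 ∤ D`. -/
theorem intPt_mem (d : ℕ) {D : ℕ} (hD : ¬ 3 ∣ D) (q : ℤ × ℤ × ℤ × ℤ) : intPt d D q ∈ threeIntegralPoints d :=
  ⟨D, hD, q, rfl⟩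

/-- `T_d ⊂ ℚ(√d)²`. -/
theorem threeIntegralPoints_subset_fieldPoints (d : ℕ) : threeIntegralPoints d ⊆ fieldPoints ℚ⟮Real.sqrt d⟯ := by
  rintro p ⟨D, -, q, rfl⟩
  have hs : Real.sqrt d ∈ ℚ⟮Real.sqrt d⟯ := mem_adjoin_simple_self ℚ _
  intro i
  fin_cases i
  · change ((q.1 : ℝ) + (q.2.1 : ℝ) * Real.sqrt d) / D ∈ ℚ⟮Real.sqrt d⟯
    exact div_mem (add_mem (intCast_mem _ _) (mul_mem (intCast_mem _ _) hs)) (_root_.natCast_mem _ D)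
  · change ((q.2.2.1 : ℝ) + (q.2.2.2 : ℝ) * Real.sqrt d) / D ∈ ℚ⟮Real.sqrt d⟯
    exact div_mem (add_mem (intCast_mem _ _) (mul_mem (intCast_mem _ _) hs)) (_root_.natCast_mem _ D)

/-- `d ≡ 2 (mod 3)` is not a square, so `√d` is irrational. -/
theorem irrational_sqrt_of_mod_three {d : ℕ} (hd : d % 3 = 2) : Irrational (Real.sqrt d) := by
  refine irrational_sqrt_natCast_iff.2 ?_
  rintro ⟨r, hr⟩
  have h3 : r * r % 3 = 2 := by rw [← hr]; exact hd
  rw [Nat.mul_mod] at h3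
  have hr3 : r % 3 < 3 := Nat.mod_lt _ (by norm_num)
  interval_cases (r % 3) <;> norm_num at h3

/-- `a + b√d = 0` with integers and `√d` irrational forces `a = 0 ∧ b = 0`. -/
theorem int_add_mul_sqrt_eq_zero {d : ℕ} (hirr : Irrational (Real.sqrt d)) {a b : ℤ}
    (h : (a : ℝ) + (b : ℝ) * Real.sqrt d = 0) : a = 0 ∧ b = 0 := by
  by_cases hb : b = 0
  · subst hb
    have : (a : ℝ) = 0 := by simpa using h
    exact ⟨by exact_mod_cast this, rfl⟩
  · exfalso
    have hne : (b : ℝ) ≠ 0 := by exact_mod_cast hb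
    refine hirr ⟨(-a) / b, ?_⟩
    push_cast
    rw [div_eq_iff hne]
    linarith

/-- Scaling the data and the denominator by the same `k ≠ 0` gives the same point (`D ≠ 0`). -/
theorem intPt_scale (d : ℕ) {D k : ℕ} (hD : D ≠ 0) (hk : k ≠ 0) (q : ℤ × ℤ × ℤ × ℤ) :
    intPt d (D * k) ((k : ℤ) * q.1, (k : ℤ) * q.2.1, (k : ℤ) * q.2.2.1, (k : ℤ) * q.2.2.2) = intPt d D q := by
  have hk' : (k : ℝ) ≠ 0 := by exact_mod_cast hk
  have hD' : (D : ℝ) ≠ 0 := by exact_mod_cast hD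
  have h0 : (((k : ℤ) * q.1 : ℤ) + (((k : ℤ) * q.2.1 : ℤ) : ℝ) * Real.sqrt d) / ((D * k : ℕ) : ℝ)
      = ((q.1 : ℝ) + (q.2.1 : ℝ) * Real.sqrt d) / D := by
    push_cast; field_simp
  have h1 : (((k : ℤ) * q.2.2.1 : ℤ) + (((k : ℤ) * q.2.2.2 : ℤ) : ℝ) * Real.sqrt d) / ((D * k : ℕ) : ℝ)
      = ((q.2.2.1 : ℝ) + (q.2.2.2 : ℝ) * Real.sqrt d) / D := by
    push_cast; field_simp
  unfold intPt
  rw [h0, h1]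

/-- UNIT DISTANCE ⇒ INTEGER UNIT STEP (common denominator, `√d` irrational): `dist (intPt d N p) (intPt d N q) = 1` with `N ≠ 0` forces
`ΔA² + d ΔB² + ΔC² + d ΔE² = N²` and `ΔA ΔB + ΔC ΔE = 0`. -/
theorem unitStep_of_dist_intPt_eq_one {d N : ℕ} (hirr : Irrational (Real.sqrt d)) (hN : N ≠ 0) {p q : ℤ × ℤ × ℤ × ℤ}
    (h : dist (intPt d N p) (intPt d N q) = 1) :
    (p.1 - q.1) ^ 2 + (d : ℤ) * (p.2.1 - q.2.1) ^ 2 + (p.2.2.1 - q.2.2.1) ^ 2 + (d : ℤ) * (p.2.2.2 - q.2.2.2) ^ 2 = (N : ℤ) ^ 2 ∧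
      (p.1 - q.1) * (p.2.1 - q.2.1) + (p.2.2.1 - q.2.2.1) * (p.2.2.2 - q.2.2.2) = 0 := by
  have hs : Real.sqrt d ^ 2 = (d : ℝ) := Real.sq_sqrt (Nat.cast_nonneg d)
  have hN' : (N : ℝ) ≠ 0 := by exact_mod_cast hN
  have hd2 : dist (intPt d N p) (intPt d N q) ^ 2 = 1 := by rw [h, one_pow]
  rw [EuclideanSpace.dist_sq_eq, Fin.sum_univ_two, Real.dist_eq, Real.dist_eq, sq_abs, sq_abs,
    intPt_apply_zero, intPt_apply_zero, intPt_apply_one, intPt_apply_one] at hd2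
  -- clear denominators: the identity `X + Y·√d = 0` with integer `X`, `Y`
  set X : ℤ := (p.1 - q.1) ^ 2 + (d : ℤ) * (p.2.1 - q.2.1) ^ 2 + (p.2.2.1 - q.2.2.1) ^ 2 + (d : ℤ) * (p.2.2.2 - q.2.2.2) ^ 2
    - (N : ℤ) ^ 2 with hX
  set Y : ℤ := 2 * ((p.1 - q.1) * (p.2.1 - q.2.1) + (p.2.2.1 - q.2.2.1) * (p.2.2.2 - q.2.2.2)) with hY
  have key : (X : ℝ) + (Y : ℝ) * Real.sqrt d = 0 := by
    rw [hX, hY]; push_cast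
    have e := hd2
    field_simp at e
    linear_combination e - (((p.2.1 : ℝ) - q.2.1) ^ 2 + ((p.2.2.2 : ℝ) - q.2.2.2) ^ 2) * hs
  obtain ⟨hX0, hY0⟩ := int_add_mul_sqrt_eq_zero hirr key
  rw [hX] at hX0
  rw [hY] at hY0
  refine ⟨by linear_combination hX0, ?_⟩
  rcases mul_eq_zero.1 hY0 with h2 | h2
  · norm_num at h2
  · exact h2

/-- Scaling law of the reduction: `redF9 (D·k) (k·q) = redF9 D q` for `3 ∤ k` (`k̄² = 1`). -/
theorem redF9_scale (D : ℤ) {k : ℤ} (hk : ¬ (3 : ℤ) ∣ k) (q : ℤ × ℤ × ℤ × ℤ) :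
    redF9 (D * k) (k * q.1, k * q.2.1, k * q.2.2.1, k * q.2.2.2) = redF9 D q := by
  have hk2 : (k : ZMod 3) ^ 2 = 1 := by
    have hne : (k : ZMod 3) ≠ 0 := by rwa [Ne, ZMod.intCast_zmod_eq_zero_iff_dvd]
    have key : ∀ z : ZMod 3, z ≠ 0 → z ^ 2 = 1 := by decide
    exact key _ hne
  simp only [redF9, Int.cast_mul, Prod.mk.injEq, F9.mk.injEq]
  refine ⟨⟨?_, ?_⟩, ?_, ?_⟩
  · linear_combination (q.1 : ZMod 3) * (D : ZMod 3) * hk2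
  · linear_combination (q.2.1 : ZMod 3) * (D : ZMod 3) * hk2
  · linear_combination (q.2.2.1 : ZMod 3) * (D : ZMod 3) * hk2
  · linear_combination (q.2.2.2 : ZMod 3) * (D : ZMod 3) * hk2

/-- The colour of a 3-integral point: reduce a chosen representation into `F₉²` and apply the linear functional. -/
def threeIntegralColour (d : ℕ) (p : threeIntegralPoints d) : ZMod 3 :=
  udF9Colour (redF9 (Classical.choose p.2 : ℕ) (Classical.choose (Classical.choose_spec p.2).2))

/-- The colour computed from ANY representation with `3 ∤ D` agrees with the colour on a unit neighbour computed from any of ITS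
representations in the only way that matters: representations of two points at distance `1` reduce to ADJACENT vertices of `UD(F₉²)`. -/
theorem redF9_adj_of_dist_eq_one {d : ℕ} (hd : d % 3 = 2) {D₁ D₂ : ℕ} (h₁ : ¬ 3 ∣ D₁) (h₂ : ¬ 3 ∣ D₂) (q₁ q₂ : ℤ × ℤ × ℤ × ℤ)
    (h : dist (intPt d D₁ q₁) (intPt d D₂ q₂) = 1) :
    (unitCircleGraph F9).Adj (redF9 D₁ q₁) (redF9 D₂ q₂) := by
  have hD₁ : D₁ ≠ 0 := by rintro rfl; exact h₁ (dvd_zero 3)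
  have hD₂ : D₂ ≠ 0 := by rintro rfl; exact h₂ (dvd_zero 3)
  -- common denominator `N = D₁ D₂`
  set P : ℤ × ℤ × ℤ × ℤ := ((D₂ : ℤ) * q₁.1, (D₂ : ℤ) * q₁.2.1, (D₂ : ℤ) * q₁.2.2.1, (D₂ : ℤ) * q₁.2.2.2) with hP
  set Q : ℤ × ℤ × ℤ × ℤ := ((D₁ : ℤ) * q₂.1, (D₁ : ℤ) * q₂.2.1, (D₁ : ℤ) * q₂.2.2.1, (D₁ : ℤ) * q₂.2.2.2) with hQ
  have eP : intPt d (D₁ * D₂) P = intPt d D₁ q₁ := intPt_scale d hD₁ hD₂ q₁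
  have eQ : intPt d (D₁ * D₂) Q = intPt d D₂ q₂ := by rw [mul_comm]; exact intPt_scale d hD₂ hD₁ q₂
  have hdist : dist (intPt d (D₁ * D₂) P) (intPt d (D₁ * D₂) Q) = 1 := by rw [eP, eQ]; exact h
  have hN : D₁ * D₂ ≠ 0 := mul_ne_zero hD₁ hD₂
  obtain ⟨u1, u2⟩ := unitStep_of_dist_intPt_eq_one (irrational_sqrt_of_mod_three hd) hN hdist
  have h3N' : ¬ 3 ∣ D₁ * D₂ := fun h => ((Nat.Prime.dvd_mul Nat.prime_three).1 h).elim h₁ h₂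
  have h3N : ¬ (3 : ℤ) ∣ ((D₁ * D₂ : ℕ) : ℤ) := by exact_mod_cast h3N'
  have hstep := redF9_unitStep (d := (d : ℤ)) (D := ((D₁ * D₂ : ℕ) : ℤ)) (by exact_mod_cast hd) h3N P Q u1 u2
  -- rewrite the two reductions back to the given representations
  have h3D₁ : ¬ (3 : ℤ) ∣ (D₁ : ℤ) := by exact_mod_cast h₁
  have h3D₂ : ¬ (3 : ℤ) ∣ (D₂ : ℤ) := by exact_mod_cast h₂
  have rP : redF9 ((D₁ * D₂ : ℕ) : ℤ) P = redF9 D₁ q₁ := by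
    rw [hP, Nat.cast_mul]; exact redF9_scale (D₁ : ℤ) h3D₂ q₁
  have rQ : redF9 ((D₁ * D₂ : ℕ) : ℤ) Q = redF9 D₂ q₂ := by
    rw [hQ, Nat.cast_mul, mul_comm]; exact redF9_scale (D₂ : ℤ) h3D₁ q₂
  rw [rP, rQ] at hstep
  exact ⟨ne_of_sq_add_sq_eq_one hstep, hstep⟩

/-- `χ(T_d) ≤ 3`: THE 3-INTEGRAL SUB-PLANE OF `ℚ(√d)²`, `d ≡ 2 (mod 3)`, IS 3-COLOURABLE. -/
theorem colorable_three_threeIntegralPoints (d : ℕ) (hd : d % 3 = 2) :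
    (planeUnitDistanceGraph.induce (threeIntegralPoints d)).Colorable 3 := by
  let C : (planeUnitDistanceGraph.induce (threeIntegralPoints d)).Coloring (ZMod 3) :=
    Coloring.mk (threeIntegralColour d) (by
      intro p q hpq
      have hdist : dist (p : EuclideanSpace ℝ (Fin 2)) q = 1 := hpq
      have ep := (Classical.choose_spec (Classical.choose_spec p.2).2 :
        (p : EuclideanSpace ℝ (Fin 2)) = intPt d (Classical.choose p.2) (Classical.choose (Classical.choose_spec p.2).2))
      have eq' := (Classical.choose_spec (Classical.choose_spec q.2).2 :
        (q : EuclideanSpace ℝ (Fin 2)) = intPt d (Classical.choose q.2) (Classical.choose (Classical.choose_spec q.2).2))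
      rw [ep, eq'] at hdist
      exact udF9Colour_proper _ _ (redF9_adj_of_dist_eq_one hd (Classical.choose_spec p.2).1 (Classical.choose_spec q.2).1 _ _ hdist))
  simpa [ZMod.card] using C.colorable

/-! ## An odd unit cycle inside `T_d` for `d ≡ 11 (mod 12)`: the zigzag on `((d−9)/(d+9), 6√d/(d+9))` -/

section Zigzag

variable (d n s g : ℕ)

/-- `x`-coordinate of the `i`-th point of the general zigzag (`n` zigzag steps of `x`-increment `s/n`, then back along the axis). -/
def gzx (i : ℕ) : ℝ := if i ≤ n then (i : ℝ) * s / n else (s : ℝ) - ((i : ℝ) - n)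

/-- `y`-coordinate: `g√d/n` at odd `i ≤ n`, else `0`. -/
def gzy (i : ℕ) : ℝ := if i ≤ n ∧ i % 2 = 1 then (g : ℝ) * Real.sqrt d / n else 0

/-- The general zigzag walk `P i`, `i = 0, …, n + s`, with `P (n + s) = P 0` when `n` is even. -/
def gzigzag (i : ℕ) : EuclideanSpace ℝ (Fin 2) := !₂[gzx n s i, gzy d n g i]

variable {d n s g}

/-- First coordinate. -/
@[simp] theorem gzigzag_apply_zero (i : ℕ) : gzigzag d n s g i 0 = gzx n s i := by simp [gzigzag]

/-- Second coordinate. -/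
@[simp] theorem gzigzag_apply_one (i : ℕ) : gzigzag d n s g i 1 = gzy d n g i := by simp [gzigzag]

/-- The walk is closed: `P (n + s) = P 0` (for even `n`). -/
theorem gzigzag_closed (hn : n % 2 = 0) : gzigzag d n s g (n + s) = gzigzag d n s g 0 := by
  have hx : gzx n s (n + s) = gzx n s 0 := by
    unfold gzx
    by_cases hs : s = 0
    · subst hs; simp
    · rw [if_neg (by omega), if_pos (Nat.zero_le _)]; push_cast; ring
  have hy : gzy d n g (n + s) = gzy d n g 0 := by
    unfold gzy
    by_cases hs : s = 0
    · subst hs; simp [hn]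
    · rw [if_neg (by omega), if_neg (by omega)]
  ext j; fin_cases j
  · simpa using hx
  · simpa using hy

/-- The unit step: `(s/n)² + (g√d/n)² = 1` when `s² + d g² = n²`. -/
theorem gzigzag_step_sq (hrel : s ^ 2 + d * g ^ 2 = n ^ 2) (hn0 : n ≠ 0) :
    ((s : ℝ) / n) ^ 2 + ((g : ℝ) * Real.sqrt d / n) ^ 2 = 1 := by
  have hs : Real.sqrt d ^ 2 = (d : ℝ) := Real.sq_sqrt (Nat.cast_nonneg d)
  have hnR : (n : ℝ) ≠ 0 := by exact_mod_cast hn0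
  have hrelR : (s : ℝ) ^ 2 + (d : ℝ) * (g : ℝ) ^ 2 = (n : ℝ) ^ 2 := by exact_mod_cast hrel
  rw [div_pow, div_pow, mul_pow, hs]
  field_simp
  linear_combination hrelR

/-- `x`-step on the zigzag part. -/
theorem gzx_sub_of_le {i : ℕ} (h1 : i + 1 ≤ n) : gzx n s i - gzx n s (i + 1) = -((s : ℝ) / n) := by
  simp only [gzx, show i ≤ n by omega, h1, if_true]
  by_cases hn0 : (n : ℝ) = 0
  · have : n = 0 := by exact_mod_cast hn0
    omega
  · push_cast; field_simp; ring

/-- `y`-step on the zigzag part, `i` even. -/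
theorem gzy_sub_of_even {i : ℕ} (h1 : i + 1 ≤ n) (hi : i % 2 = 0) :
    gzy d n g i - gzy d n g (i + 1) = -((g : ℝ) * Real.sqrt d / n) := by
  simp only [gzy, show ¬ (i ≤ n ∧ i % 2 = 1) by omega, show (i + 1 ≤ n ∧ (i + 1) % 2 = 1) by omega, if_false, if_true, and_self]
  ring

/-- `y`-step on the zigzag part, `i` odd. -/
theorem gzy_sub_of_odd {i : ℕ} (h1 : i + 1 ≤ n) (hi : i % 2 = 1) :
    gzy d n g i - gzy d n g (i + 1) = (g : ℝ) * Real.sqrt d / n := by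
  simp only [gzy, show (i ≤ n ∧ i % 2 = 1) by omega, show ¬ (i + 1 ≤ n ∧ (i + 1) % 2 = 1) by omega, if_false, if_true, and_self]
  ring

/-- Steps on the way back (including the corner `i = n`, where `y = 0` because `n` is even): `x` decreases by `1`, `y = 0`. -/
theorem gz_sub_of_ge {i : ℕ} (hn : n % 2 = 0) (hn0 : n ≠ 0) (h1 : n ≤ i) :
    gzx n s i - gzx n s (i + 1) = 1 ∧ gzy d n g i - gzy d n g (i + 1) = 0 := by
  constructor
  · by_cases h2 : i ≤ n
    · have hi : i = n := le_antisymm h2 h1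
      subst hi
      simp only [gzx, le_refl, if_true, show ¬ (i + 1 ≤ i) by omega, if_false]
      have hiR : (i : ℝ) ≠ 0 := by exact_mod_cast hn0
      push_cast; field_simp; ring
    · simp only [gzx, h2, show ¬ (i + 1 ≤ n) by omega, if_false]
      push_cast; ring
  · simp only [gzy, show ¬ (i ≤ n ∧ i % 2 = 1) by omega, show ¬ (i + 1 ≤ n ∧ (i + 1) % 2 = 1) by omega, if_false, sub_zero]

/-- Consecutive points of the general zigzag are at distance `1`. -/
theorem dist_gzigzag_succ (hrel : s ^ 2 + d * g ^ 2 = n ^ 2) (hn : n % 2 = 0) (hn0 : n ≠ 0) (i : ℕ) :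
    dist (gzigzag d n s g i) (gzigzag d n s g (i + 1)) = 1 := by
  apply dist_eq_one_of_sq
  rw [gzigzag_apply_zero, gzigzag_apply_zero, gzigzag_apply_one, gzigzag_apply_one]
  have hstep := gzigzag_step_sq hrel hn0
  by_cases h1 : i + 1 ≤ n
  · rw [gzx_sub_of_le h1]
    rcases Nat.even_or_odd i with ⟨m, hm⟩ | ⟨m, hm⟩
    · rw [gzy_sub_of_even h1 (by omega), neg_sq, neg_sq]; exact hstep
    · rw [gzy_sub_of_odd h1 (by omega), neg_sq]; exact hstep
  · obtain ⟨hx, hy⟩ := gz_sub_of_ge (d := d) (s := s) (g := g) hn hn0 (show n ≤ i by omega)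
    rw [hx, hy]; norm_num

/-- The zigzag points are 3-integral when `3 ∤ n`: `P i = intPt d n (i s, 0, 0, g or 0)` on the way out, `intPt d 1 (…, 0, 0, 0)` on the way back. -/
theorem gzigzag_mem_threeIntegralPoints (h3 : ¬ 3 ∣ n) (i : ℕ) : gzigzag d n s g i ∈ threeIntegralPoints d := by
  by_cases hi : i ≤ n
  · refine ⟨n, h3, (((i * s : ℕ) : ℤ), 0, 0, if i % 2 = 1 then (g : ℤ) else 0), ?_⟩
    ext j; fin_cases j
    · simp [gzx, hi, intPt]
    · by_cases hodd : i % 2 = 1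
      · simp [gzy, hi, hodd, intPt]
      · simp [gzy, hi, hodd, intPt]
  · refine ⟨1, by norm_num, (((s : ℤ) - ((i : ℤ) - n)), 0, 0, 0), ?_⟩
    ext j; fin_cases j
    · simp [gzx, hi, intPt]
    · simp [gzy, hi, intPt]

end Zigzag

/-- ODD CYCLE INSIDE `T_d`: for `d ≡ 11 (mod 12)` the 3-integral sub-plane is not bipartite.  The walk: `n = (d+9)/2` (even, prime to `3`),
`s = (d−9)/2`, `g = 3` (`s² + 9d = n²`), of odd length `n + s = d`. -/
theorem not_colorable_two_threeIntegralPoints (d : ℕ) (hd : d % 12 = 11) :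
    ¬ (planeUnitDistanceGraph.induce (threeIntegralPoints d)).Colorable 2 := by
  rintro ⟨C⟩
  set n := (d + 9) / 2 with hn
  set s := (d - 9) / 2 with hs
  have hd9 : 9 ≤ d := by omega
  have hn2 : 2 * n = d + 9 := by omega
  have hs2 : 2 * s = d - 9 := by omega
  have hrel : s ^ 2 + d * 3 ^ 2 = n ^ 2 := by nlinarith [hn2, hs2, hd9, Nat.sub_add_cancel hd9]
  have hneven : n % 2 = 0 := by omega
  have hn0 : n ≠ 0 := by omega
  have h3n : ¬ 3 ∣ n := by omega
  let w : ℕ → Fin 2 := fun i => C ⟨gzigzag d n s 3 i, gzigzag_mem_threeIntegralPoints h3n i⟩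
  have hstep : ∀ i, w i ≠ w (i + 1) := fun i =>
    C.valid (show (planeUnitDistanceGraph.induce (threeIntegralPoints d)).Adj _ _ from dist_gzigzag_succ hrel hneven hn0 i)
  have key : ∀ x y z : Fin 2, x ≠ y → (y = z ↔ ¬ x = z) := by decide
  have hpar : ∀ i, (w i = w 0 ↔ i % 2 = 0) := by
    intro i
    induction i with
    | zero => simp
    | succ m ih => rw [key _ _ (w 0) (hstep m), ih]; omega
  have hclosed : w (n + s) = w 0 := by
    simp only [w]
    congr 1
    exact Subtype.ext (gzigzag_closed hneven)
  have := (hpar (n + s)).1 hclosed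
  omega

/-- `χ(T_d) = 3` EXACTLY for `d ≡ 11 (mod 12)` (e.g. `d = 83`: `χ(ℚ(√83)²) ∈ {3, 4}` is open, but its 3-integral sub-plane is settled). -/
theorem chromaticNumber_threeIntegralPoints (d : ℕ) (hd : d % 12 = 11) :
    (planeUnitDistanceGraph.induce (threeIntegralPoints d)).chromaticNumber = 3 :=
  chromaticNumber_eq_iff_colorable_not_colorable.mpr
    ⟨colorable_three_threeIntegralPoints d (by omega), not_colorable_two_threeIntegralPoints d hd⟩

/-- The instance the census cares about: `χ(T₈₃) = 3`. -/
theorem chromaticNumber_threeIntegralPoints_83 :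
    (planeUnitDistanceGraph.induce (threeIntegralPoints 83)).chromaticNumber = 3 :=
  chromaticNumber_threeIntegralPoints 83 (by norm_num)

/-- WITNESSES NEED A `3` IN THE DENOMINATOR: a finite graph realised by points of `T_d` (`d ≡ 2 (mod 3)`) at unit distances is 3-colourable;
equivalently no `4`-chromatic unit-distance graph of `ℚ(√d)²` lies in `T_d`. -/
theorem colorable_three_of_realisation_threeIntegral {V : Type*} {G : SimpleGraph V} {d : ℕ} (hd : d % 3 = 2)
    (p : V → EuclideanSpace ℝ (Fin 2)) (hmem : ∀ v, p v ∈ threeIntegralPoints d)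
    (hadj : ∀ ⦃v w : V⦄, G.Adj v w → dist (p v) (p w) = 1) : G.Colorable 3 := by
  let f : G →g planeUnitDistanceGraph.induce (threeIntegralPoints d) :=
    { toFun := fun v => ⟨p v, hmem v⟩
      map_rel' := fun h => hadj h }
  exact (colorable_three_threeIntegralPoints d hd).of_hom f

/-- SUMMARY: `T_d` is 3-colourable for every `d ≡ 2 (mod 3)` and has chromatic number exactly `3` for every `d ≡ 11 (mod 12)`. -/
theorem threeIntegralPlane_summary :
    (∀ d : ℕ, d % 3 = 2 → (planeUnitDistanceGraph.induce (threeIntegralPoints d)).Colorable 3) ∧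
    (∀ d : ℕ, d % 12 = 11 → (planeUnitDistanceGraph.induce (threeIntegralPoints d)).chromaticNumber = 3) :=
  ⟨colorable_three_threeIntegralPoints, chromaticNumber_threeIntegralPoints⟩

end Summit.Ventures.DiscreteObjects.UnitDistance
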